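import Summits.ResolutionOfSingularities.ResolutionOfSingularities.Theorems.WildQuotientsSummitReductionStubPairQuasiSplitBaseChangeLevels
import Summits.ResolutionOfSingularities.ResolutionOfSingularities.Theorems.WildQuotientsSummitReductionStubPairOrbitBlowupCentreLocalLemmas
import Literature.AlgebraicGeometry.Resolution.AlterationsSemiStableCodimTwoBlowupReduction
import Mathlib.RingTheory.Localization.BaseChange
import Mathlib.RingTheory.Localization.LocalizationLocalization
import HarnessLib

/-!
# `WildQuotients.SummitReduction` (stmt-ResolutionOfSingularities-16324), line `FramePerfect`:
# the chart models `k[x, y]/(xy - ā)` after extension of the ground field — local rings at all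
# points (algebra of stub `stub_pair_orbitBlowupCentreLocal`, file 10)

Route `ResolutionOfSingularities/WildQuotients`, crux `SummitReduction`; helper file of stub
`stub_pair_orbitBlowupCentreLocal` (C2: de Jong 1996, 3.4 Claim (ii) over the orbit centre). The
special fibres of the three charts of the blow-up are `k[x, y]/(xy - ā)`
(`DeJong1996.AlgebraicNodeRing k ā`; "This scheme is smooth over `k`, except at the maximal ideal
`(u, t₁')`", de Jong 1996, p. 64). The engine of file 9 compares the local rings of the GEOMETRIC
fibres of the blown-up curve with the local rings of `k' ⊗_k (k[x, y]/(xy - ā))_𝔔` at primes over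
`𝔔`, for field extensions `k'/k`; this file PROVES what is needed about the latter:

* `isRegularLocalRing_localization_of_not_mem` — **`k[x, y]/(xy - ā)` is regular at every prime
  not containing both `x̄` and `ȳ`** (Jacobian criterion, Stacks 07PF: the partials `y`, `x` of
  `xy - ā` do not both lie in the prime; the tree's `isRegularLocalRing_localization_ker` is the
  case of a `k`-point);
* `ringKrullDim_localization_eq_one_of_isMaximal` — its local rings at maximal ideals have
  dimension `1` (`k[x, y]_𝔮/(f)`, `ht 𝔮 = 2`, `f ≠ 0`);
* `exists_baseChange_algebraicNodeRing_equiv_of_param` — `k' ⊗_k k[x, y]/(xy - ā) ≅ k'[x, y]/(xy - ā)`;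
* `isRegularLocalRing_and_ringKrullDim_localization_baseChange` (entry) — **for a prime `𝔔` of
  `k[x, y]/(xy - ā)` and a prime `𝔑'` of `k' ⊗_k (k[x, y]/(xy - ā))_𝔔` over `𝔔`: the local ring at
  `𝔑'` is regular if `𝔔 ∌ x̄` or `𝔔 ∌ ȳ`, and has dimension `1` if `𝔑'` is `k'`-rational** (it is a
  local ring of `k'[x, y]/(xy - ā)` at a prime over `𝔔`, maximal in the rational case).
-/

set_option linter.dupNamespace false

noncomputable section

open IsLocalRing TensorProduct MvPolynomial
open Literature.AlgebraicGeometry.Resolution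
open Literature.AlgebraicGeometry.Resolution.DeJong1996

namespace Summit.ResolutionOfSingularities.ResolutionOfSingularities.Theorems

universe u

/-! ## Local rings of `k[x, y]/(xy - ā)` at arbitrary primes -/

section Points

variable (k : Type u) [Field k] (a : k)

/-- **`k[x, y]/(xy - ā)` is regular at every prime not containing both `x̄` and `ȳ`** (Jacobian
criterion, The Stacks Project, Tag 07PF, read contrapositively through the tree's
`Derivation.apply_mem_comap_of_not_isRegularLocalRing`: at a non-regular prime both partials `y`
and `x` of `xy - ā` lie in the prime). [cite: StacksProject, Tag 07PF] -/
theorem isRegularLocalRing_localization_of_not_mem (𝔓 : Ideal (AlgebraicNodeRing k a)) [𝔓.IsPrime]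
    (h : ¬ (AlgebraicNodeRing.u k a ∈ 𝔓 ∧ AlgebraicNodeRing.v k a ∈ 𝔓)) : IsRegularLocalRing (Localization.AtPrime 𝔓) := by
  by_contra hreg
  have key : ∀ i : Fin 2, (pderiv i (algNodeRelation k a) : MvPolynomial (Fin 2) k) ∈
      𝔓.comap (Ideal.Quotient.mk (Ideal.span {algNodeRelation k a})) :=
    fun i => Derivation.apply_mem_comap_of_not_isRegularLocalRing (pderiv i) _ _ hreg
  have h0 := key 0
  have h1 := key 1
  rw [AlgebraicNodeRing.pderiv_algNodeRelation_zero, Ideal.mem_comap] at h0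
  rw [AlgebraicNodeRing.pderiv_algNodeRelation_one, Ideal.mem_comap] at h1
  exact h ⟨h1, h0⟩

/-- **The local rings of `k[x, y]/(xy - ā)` at maximal ideals have dimension `1`**: such a local
ring is `k[x, y]_𝔮/(xy - ā)` for a maximal ideal `𝔮` of `k[x, y]`, of height `2`, and
`xy - ā ≠ 0` (the tree's `ringKrullDim_localization_ker` is the case of a `k`-point). [folklore] -/
theorem ringKrullDim_localization_eq_one_of_isMaximal (𝔓 : Ideal (AlgebraicNodeRing k a))
    [h𝔓 : 𝔓.IsMaximal] : ringKrullDim (Localization.AtPrime 𝔓) = 1 := by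
  set Q : Ideal (MvPolynomial (Fin 2) k) :=
    𝔓.comap (Ideal.Quotient.mk (Ideal.span {algNodeRelation k a})) with hQ
  haveI hQmax : Q.IsMaximal := by
    rw [hQ]
    exact Ideal.comap_isMaximal_of_surjective _ Ideal.Quotient.mk_surjective
  rw [ringKrullDim_eq_of_ringEquiv (localizationQuotientEquiv (algNodeRelation k a) 𝔓)]
  set L := Localization.AtPrime Q with hL
  have hdimL : ringKrullDim L = (2 : ℕ) := by
    rw [IsLocalization.AtPrime.ringKrullDim_eq_height Q L, MvPolynomial.height_eq_of_isMaximal k 2 Q]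
    rfl
  have hf0 : algNodeRelation k a ≠ 0 := by
    intro h0
    have h1 := congrArg (coeff (Finsupp.single 0 1 + Finsupp.single 1 1)) h0
    rw [algNodeRelation, coeff_sub, coeff_C, coeff_zero] at h1
    have hX : (X 0 * X 1 : MvPolynomial (Fin 2) k) = monomial (Finsupp.single 0 1 + Finsupp.single 1 1) 1 := by
      rw [X, X, monomial_mul, mul_one]
    rw [hX, coeff_monomial, if_pos rfl, if_neg] at h1
    · simp at h1
    · intro h; have := congrArg (fun f => f 0) h; simp at this
  have hfm : algebraMap _ L (algNodeRelation k a) ∈ maximalIdeal L := by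
    rw [← Localization.AtPrime.map_eq_maximalIdeal]
    exact Ideal.mem_map_of_mem _ (mem_comap_mk_span_singleton (algNodeRelation k a) 𝔓)
  have hfnz : algebraMap _ L (algNodeRelation k a) ∈ nonZeroDivisors L := by
    refine mem_nonZeroDivisors_of_ne_zero fun h0 => hf0 ?_
    exact IsLocalization.injective L Q.primeCompl_le_nonZeroDivisors (by rw [h0, map_zero])
  have hquot := ringKrullDim_quotient_span_singleton_succ_eq_ringKrullDim_of_mem_nonZeroDivisors
    hfnz hfm
  rw [hdimL] at hquot
  exact WithBot.ENat.eq_one_of_add_one_eq_two hquot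

end Points

/-! ## Base change of `k[x, y]/(xy - ā)` -/

section BaseChange

variable (k : Type u) [Field k] (a : k) (k' : Type u) [Field k'] [Algebra k k']

/-- **Base change of the model: `k' ⊗_k k[x, y]/(xy - ā) ≅ k'[x, y]/(xy - ā)`** as `k'`-algebras,
sending `1 ⊗ p̄ ↦ p̄` (Mathlib's `MvPolynomial.algebraTensorAlgEquiv` and `tensorQuotientEquiv`; the
tree's `exists_baseChange_algebraicNodeRing_equiv` is the case `ā = 0`). [folklore] -/
theorem exists_baseChange_algebraicNodeRing_equiv_of_param :
    ∃ β : k' ⊗[k] AlgebraicNodeRing k a ≃ₐ[k'] AlgebraicNodeRing k' (algebraMap k k' a),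
      ∀ p : MvPolynomial (Fin 2) k, β ((1 : k') ⊗ₜ[k] AlgebraicNodeRing.mk k a p) =
        AlgebraicNodeRing.mk k' (algebraMap k k' a) (MvPolynomial.map (algebraMap k k') p) := by
  let J : Ideal (MvPolynomial (Fin 2) k) := Ideal.span {algNodeRelation k a}
  let J' : Ideal (MvPolynomial (Fin 2) k') := Ideal.span {algNodeRelation k' (algebraMap k k' a)}
  let e₁ : k' ⊗[k] AlgebraicNodeRing k a ≃ₐ[k'] (k' ⊗[k] MvPolynomial (Fin 2) k) ⧸ J.map
      (Algebra.TensorProduct.includeRight : MvPolynomial (Fin 2) k →ₐ[k] k' ⊗[k] MvPolynomial (Fin 2) k) :=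
    Algebra.TensorProduct.tensorQuotientEquiv k' (MvPolynomial (Fin 2) k) k' J
  let α : k' ⊗[k] MvPolynomial (Fin 2) k ≃ₐ[k'] MvPolynomial (Fin 2) k' :=
    MvPolynomial.algebraTensorAlgEquiv k k'
  have hα : ∀ p : MvPolynomial (Fin 2) k, α ((1 : k') ⊗ₜ[k] p) = MvPolynomial.map (algebraMap k k') p :=
    fun p => by
    simp only [α, MvPolynomial.algebraTensorAlgEquiv_tmul, one_smul]
  have hJα : J' = (J.map (Algebra.TensorProduct.includeRight :
      MvPolynomial (Fin 2) k →ₐ[k] k' ⊗[k] MvPolynomial (Fin 2) k)).map (α : _ →+* _) := by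
    simp only [J, J']
    rw [Ideal.map_span, Set.image_singleton, Ideal.map_span, Set.image_singleton]
    congr 2
    change algNodeRelation k' (algebraMap k k' a) = α ((Algebra.TensorProduct.includeRight :
      MvPolynomial (Fin 2) k →ₐ[k] k' ⊗[k] MvPolynomial (Fin 2) k) (algNodeRelation k a))
    rw [Algebra.TensorProduct.includeRight_apply, hα, AlgebraicNodeRing.map_algNodeRelation]
  let e₂ : ((k' ⊗[k] MvPolynomial (Fin 2) k) ⧸ J.map (Algebra.TensorProduct.includeRight :
      MvPolynomial (Fin 2) k →ₐ[k] k' ⊗[k] MvPolynomial (Fin 2) k)) ≃ₐ[k']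
      AlgebraicNodeRing k' (algebraMap k k' a) :=
    Ideal.quotientEquivAlg _ J' α (by rw [hJα])
  refine ⟨e₁.trans e₂, fun p => ?_⟩
  rw [AlgEquiv.trans_apply]
  simp only [e₁, e₂, AlgebraicNodeRing.mk_apply]
  rw [Algebra.TensorProduct.tensorQuotientEquiv_apply_tmul]
  change Ideal.quotientEquivAlg _ J' α _ (Ideal.Quotient.mk _ ((1 : k') ⊗ₜ[k] p)) = _
  rw [Ideal.quotientEquivAlg_mk]
  congr 1
  exact hα p

end BaseChange

/-! ## Local rings of the base-changed local model -/

section Main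

/-- In a prime quotient onto which a field maps surjectively, the ideal is maximal. [folklore] -/
theorem isMaximal_of_surjective_algebraMap {k' : Type u} [Field k'] {D : Type u} [CommRing D]
    [Algebra k' D] (P : Ideal D) [P.IsPrime]
    (h : Function.Surjective ((Ideal.Quotient.mk P).comp (algebraMap k' D))) : P.IsMaximal := by
  refine Ideal.Quotient.maximal_of_isField _ ?_
  haveI : Nontrivial (D ⧸ P) := Ideal.Quotient.nontrivial_iff.mpr (Ideal.IsPrime.ne_top inferInstance)
  have hinj : Function.Injective ((Ideal.Quotient.mk P).comp (algebraMap k' D)) :=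
    ((Ideal.Quotient.mk P).comp (algebraMap k' D)).injective
  let e := RingEquiv.ofBijective _ ⟨hinj, h⟩
  exact MulEquiv.isField (Field.toIsField k') e.symm.toMulEquiv

/-- Rationality passes along a `k'`-algebra map to the contracted prime. [folklore] -/
theorem surjective_mk_comp_algebraMap_of_eq_comap {k' : Type u} [Field k'] {S T : Type u} [CommRing S]
    [CommRing T] [Algebra k' S] [Algebra k' T] (f : S →ₐ[k'] T) (𝔑' : Ideal T) (𝔑 : Ideal S)
    (h𝔑 : 𝔑 = 𝔑'.comap f.toRingHom)
    (h : Function.Surjective ((Ideal.Quotient.mk 𝔑').comp (algebraMap k' T))) :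
    Function.Surjective ((Ideal.Quotient.mk 𝔑).comp (algebraMap k' S)) := by
  subst h𝔑
  intro z
  obtain ⟨s, rfl⟩ := Ideal.Quotient.mk_surjective z
  obtain ⟨c, hc⟩ := h (Ideal.Quotient.mk 𝔑' (f s))
  refine ⟨c, ?_⟩
  rw [RingHom.comp_apply, Ideal.Quotient.mk_eq_mk_iff_sub_mem, Ideal.mem_comap, map_sub,
    AlgHom.toRingHom_eq_coe, RingHom.coe_coe, AlgHom.commutes]
  rw [RingHom.comp_apply, Ideal.Quotient.mk_eq_mk_iff_sub_mem] at hc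
  exact hc

set_option maxHeartbeats 800000 in
/-- **The local ring of `k' ⊗_k C` at a prime over `𝔪_C` is a local ring of `k'[x, y]/(xy - ā)`**, for
`C` a local ring of (a copy `N` of) the model `k[x, y]/(xy - ā)` at a prime `𝔔` and `k'/k` a field
extension: `k' ⊗_k C = (k' ⊗_k N)_{N ∖ 𝔔}` (base change commutes with localization, Mathlib's
`IsLocalization.tensorProductEquivOfMapIncludeRight`), so the local ring at `𝔑'` is the local ring
of `k' ⊗_k N ≅ k'[x, y]/(xy - ā)` (`exists_baseChange_algebraicNodeRing_equiv_of_param`) at a prime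
`𝔓` over `𝔔` — containing `x̄` (resp. `ȳ`) iff `𝔔` does, and maximal if `𝔑'` is `k'`-rational.
[cite: DeJong1996, 3.4 Claim (ii), p. 64] -/
theorem exists_prime_model_localization_equiv (k k' : Type u) [Field k] [Field k'] [Algebra k k'] (a : k)
    (N : Type u) [CommRing N] [Algebra k N] (ν : N ≃ₐ[k] AlgebraicNodeRing k a)
    (𝔔 : Ideal N) [𝔔.IsPrime]
    (C : Type u) [CommRing C] [Algebra N C] [IsLocalization.AtPrime C 𝔔] [Algebra k C]
    [IsScalarTower k N C] [IsLocalRing C]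
    (𝔑' : Ideal (k' ⊗[k] C)) [𝔑'.IsPrime] (h𝔑' : (maximalIdeal C).map (tensorInr k k' C) ≤ 𝔑') :
    ∃ (𝔓 : Ideal (AlgebraicNodeRing k' (algebraMap k k' a))) (_ : 𝔓.IsPrime),
      Nonempty (Localization.AtPrime 𝔑' ≃+* Localization.AtPrime 𝔓) ∧
      (AlgebraicNodeRing.u k' (algebraMap k k' a) ∈ 𝔓 ↔ ν.symm (AlgebraicNodeRing.u k a) ∈ 𝔔) ∧
      (AlgebraicNodeRing.v k' (algebraMap k k' a) ∈ 𝔓 ↔ ν.symm (AlgebraicNodeRing.v k a) ∈ 𝔔) ∧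
      (Function.Surjective ((Ideal.Quotient.mk 𝔑').comp (algebraMap k' (k' ⊗[k] C))) → 𝔓.IsMaximal) := by
  -- `k' ⊗ C ≅ Cₜ`, the localization of `k' ⊗ N` at the image of `N ∖ 𝔔`
  obtain ⟨e, he⟩ : ∃ e : k' ⊗[k] C ≃ₐ[k'] Localization (𝔔.primeCompl.map
      (Algebra.TensorProduct.includeRight (R := k) (A := k') (B := N))),
      ∀ (x : k') (n : N), e (x ⊗ₜ algebraMap N C n) = algebraMap _ _ (x ⊗ₜ n) :=
    ⟨IsLocalization.tensorProductEquivOfMapIncludeRight k k' 𝔔.primeCompl C _,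
      fun x n => IsLocalization.tensorProductEquivOfMapIncludeRight_tmul (R := k) (S := k') N
        𝔔.primeCompl C _ x n⟩
  -- the prime `𝔑ₜ` corresponding to `𝔑'`, and the local ring at `𝔑'`
  obtain ⟨ρ₁, -⟩ := exists_localization_ringEquiv_of_ringEquiv e.symm.toRingEquiv 𝔑'
  obtain ⟨𝔑ₜ, h𝔑ₜ⟩ : ∃ 𝔑ₜ : Ideal (Localization (𝔔.primeCompl.map
      (Algebra.TensorProduct.includeRight (R := k) (A := k') (B := N)))),
      𝔑ₜ = 𝔑'.comap e.symm.toRingEquiv.toRingHom := ⟨_, rfl⟩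
  haveI h𝔑ₜp : 𝔑ₜ.IsPrime := by rw [h𝔑ₜ]; exact Ideal.comap_isPrime _ 𝔑'
  have ρ₁' : Localization.AtPrime 𝔑' ≃+* Localization.AtPrime 𝔑ₜ := by subst h𝔑ₜ; exact ρ₁
  -- its contraction `𝔓₀` to `k' ⊗ N`: the local ring at `𝔑ₜ` is `(k' ⊗ N)_{𝔓₀}`
  obtain ⟨𝔓₀, h𝔓₀⟩ : ∃ 𝔓₀ : Ideal (k' ⊗[k] N), 𝔓₀ = 𝔑ₜ.comap (algebraMap _ _) := ⟨_, rfl⟩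
  haveI : 𝔓₀.IsPrime := by rw [h𝔓₀]; exact Ideal.comap_isPrime _ 𝔑ₜ
  have ρ₂ : Localization.AtPrime 𝔓₀ ≃ₐ[k' ⊗[k] N] Localization.AtPrime 𝔑ₜ := by
    subst h𝔓₀; exact IsLocalization.localizationLocalizationAtPrimeIsoLocalization _ 𝔑ₜ
  -- transport to `N' = k'[x, y]/(xy - ā)` along `β`
  obtain ⟨β₀, hβ₀⟩ := exists_baseChange_algebraicNodeRing_equiv_of_param k a k'
  let β : k' ⊗[k] N ≃ₐ[k'] AlgebraicNodeRing k' (algebraMap k k' a) :=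
    (Algebra.TensorProduct.congr (AlgEquiv.refl : k' ≃ₐ[k'] k') ν).trans β₀
  have hβ1 : ∀ n : N, β ((1 : k') ⊗ₜ n) = β₀ ((1 : k') ⊗ₜ ν n) := fun n => by
    simp only [β, AlgEquiv.trans_apply, Algebra.TensorProduct.congr_apply, AlgEquiv.refl_toAlgHom,
      Algebra.TensorProduct.map_tmul, AlgHom.coe_id, id_eq]
    rfl
  obtain ⟨ρ₃, -⟩ := exists_localization_ringEquiv_of_ringEquiv β.symm.toRingEquiv 𝔓₀
  obtain ⟨𝔓, h𝔓def⟩ : ∃ 𝔓 : Ideal (AlgebraicNodeRing k' (algebraMap k k' a)),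
      𝔓 = 𝔓₀.comap β.symm.toRingEquiv.toRingHom := ⟨_, rfl⟩
  haveI : 𝔓.IsPrime := by rw [h𝔓def]; exact Ideal.comap_isPrime _ 𝔓₀
  have ρ₃' : Localization.AtPrime 𝔓₀ ≃+* Localization.AtPrime 𝔓 := by subst h𝔓def; exact ρ₃
  -- membership of `x̄`, `ȳ`
  have hcomapC : 𝔑'.comap (tensorInr k k' C) = maximalIdeal C := by
    refine ((IsLocalRing.maximalIdeal.isMaximal _).eq_of_le ?_ ?_).symm
    · exact Ideal.comap_ne_top _ (Ideal.IsPrime.ne_top inferInstance)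
    · rw [← Ideal.map_le_iff_le_comap]; exact h𝔑'
  have hmem𝔓 : ∀ x, β x ∈ 𝔓 ↔ x ∈ 𝔓₀ := fun x => by
    rw [h𝔓def, Ideal.mem_comap]
    change β.symm (β x) ∈ 𝔓₀ ↔ _
    rw [AlgEquiv.symm_apply_apply]
  have hmemN : ∀ n : N, β ((1 : k') ⊗ₜ n) ∈ 𝔓 ↔ n ∈ 𝔔 := fun n => by
    rw [hmem𝔓, h𝔓₀, Ideal.mem_comap, ← he, h𝔑ₜ, Ideal.mem_comap]
    change e.symm (e _) ∈ 𝔑' ↔ _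
    rw [AlgEquiv.symm_apply_apply, ← tensorInr_apply, ← Ideal.mem_comap, hcomapC]
    exact IsLocalization.AtPrime.to_map_mem_maximal_iff C 𝔔 n
  have hu : AlgebraicNodeRing.u k' (algebraMap k k' a) ∈ 𝔓 ↔ ν.symm (AlgebraicNodeRing.u k a) ∈ 𝔔 := by
    rw [← hmemN, hβ1, AlgEquiv.apply_symm_apply, AlgebraicNodeRing.u, AlgebraicNodeRing.u, hβ₀,
      MvPolynomial.map_X]
  have hv : AlgebraicNodeRing.v k' (algebraMap k k' a) ∈ 𝔓 ↔ ν.symm (AlgebraicNodeRing.v k a) ∈ 𝔔 := by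
    rw [← hmemN, hβ1, AlgEquiv.apply_symm_apply, AlgebraicNodeRing.v, AlgebraicNodeRing.v, hβ₀,
      MvPolynomial.map_X]
  refine ⟨𝔓, inferInstance, ⟨ρ₁'.trans (ρ₂.symm.toRingEquiv.trans ρ₃')⟩, hu, hv, fun hsurj => ?_⟩
  -- rationality of `𝔑'` ⇒ of `𝔑ₜ` ⇒ of `𝔓₀` ⇒ `𝔓` maximal
  have h1 : Function.Surjective ((Ideal.Quotient.mk 𝔑ₜ).comp (algebraMap k' _)) :=
    surjective_mk_comp_algebraMap_of_eq_comap (e.symm : _ →ₐ[k'] _) 𝔑' 𝔑ₜ h𝔑ₜ hsurj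
  have h2 : Function.Surjective ((Ideal.Quotient.mk 𝔓₀).comp (algebraMap k' _)) :=
    surjective_mk_comp_algebraMap_of_eq_comap (IsScalarTower.toAlgHom k' (k' ⊗[k] N) _) 𝔑ₜ 𝔓₀ h𝔓₀ h1
  haveI h𝔓₀max : 𝔓₀.IsMaximal := isMaximal_of_surjective_algebraMap 𝔓₀ h2
  rw [h𝔓def]
  exact Ideal.comap_isMaximal_of_surjective _ β.symm.surjective

/-- **The local rings of `k' ⊗_k (k[x, y]/(xy - ā))_𝔔` at primes over `𝔔`** (entry theorem; `N` a
copy of the model `k[x, y]/(xy - ā)` through `ν`, `C` its local ring at `𝔔`, `k'/k` a field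
extension, `𝔑'` a prime of `k' ⊗_k C` over `𝔪_C`): the local ring at `𝔑'` is **regular if
`𝔔 ∌ x̄` or `𝔔 ∌ ȳ`** ("This scheme is smooth over `k`, except at the maximal ideal `(u, t₁')`",
de Jong 1996, p. 64: it is a local ring of `k'[x, y]/(xy - ā)` at a prime not containing both
`x̄`, `ȳ`, `isRegularLocalRing_localization_of_not_mem`) and **of dimension `1` if `𝔑'` is
`k'`-rational** (then that prime is maximal, `ringKrullDim_localization_eq_one_of_isMaximal`).
[cite: DeJong1996, 3.4 Claim (ii), p. 64] -/
theorem isRegularLocalRing_and_ringKrullDim_localization_baseChange (k k' : Type u) [Field k]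
    [Field k'] [Algebra k k'] (a : k) (N : Type u) [CommRing N] [Algebra k N]
    (ν : N ≃ₐ[k] AlgebraicNodeRing k a) (𝔔 : Ideal N) [𝔔.IsPrime]
    (C : Type u) [CommRing C] [Algebra N C] [IsLocalization.AtPrime C 𝔔] [Algebra k C]
    [IsScalarTower k N C] [IsLocalRing C]
    (𝔑' : Ideal (k' ⊗[k] C)) [𝔑'.IsPrime] (h𝔑' : (maximalIdeal C).map (tensorInr k k' C) ≤ 𝔑') :
    (¬ (ν.symm (AlgebraicNodeRing.u k a) ∈ 𝔔 ∧ ν.symm (AlgebraicNodeRing.v k a) ∈ 𝔔) →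
      IsRegularLocalRing (Localization.AtPrime 𝔑')) ∧
    (Function.Surjective ((Ideal.Quotient.mk 𝔑').comp (algebraMap k' (k' ⊗[k] C))) →
      ringKrullDim (Localization.AtPrime 𝔑') = 1) := by
  obtain ⟨𝔓, h𝔓p, ⟨ρ⟩, hu, hv, hmax⟩ :=
    exists_prime_model_localization_equiv k k' a N ν 𝔔 C 𝔑' h𝔑'
  refine ⟨fun hoff => ?_, fun hsurj => ?_⟩
  · have hoff' : ¬ (AlgebraicNodeRing.u k' (algebraMap k k' a) ∈ 𝔓 ∧
        AlgebraicNodeRing.v k' (algebraMap k k' a) ∈ 𝔓) := by rwa [hu, hv]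
    haveI := isRegularLocalRing_localization_of_not_mem k' (algebraMap k k' a) 𝔓 hoff'
    exact IsRegularLocalRing.of_ringEquiv (R := Localization.AtPrime 𝔓) (R' := Localization.AtPrime 𝔑') ρ.symm
  · haveI := hmax hsurj
    rw [ringKrullDim_eq_of_ringEquiv ρ]
    exact ringKrullDim_localization_eq_one_of_isMaximal k' (algebraMap k k' a) 𝔓

end Main

end Summit.ResolutionOfSingularities.ResolutionOfSingularities.Theorems

end
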